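import Summits.QuantumAdvantage.AdviceFreeQNC0.AffBells21GenericCount
import HarnessLib

/-!
# Cell qa-qnc0, plan S2 cube side: the first rung (P2-generic) `ParityMod3GenericBound` — PROVED

Planner qa-qnc0-p1 g21, `Sketch21.lean` §2f (statement VERBATIM), ROUND-20 §2.8; support for crux `RingDenseResidualLt3`
(stmt-QuantumAdvantage-22907), route `DWalkThree`.  For all but an exponentially small fraction of coefficient matrices
`B ∈ (𝔽₃^q)^{2q}` — the regime `s/q = 2` where every Fourier-norm argument is void — the parity of the `2q` affine
`MOD₃` conditions has bias `≤ 1 − c` for EVERY residue vector `r` and EVERY `𝔽₂`-linear term `λ`.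

PROOF (kernel, 0 sorry; `c = 10⁻⁵`, `q₀ = 100`): the one-path descent (`AffBells21GenericPath.one_sub_abs_bias_ge`:
three moves of (DL) along `x = (0,0)`, `x' = (1,0)` at the coin pairs `(0,1),(2,3),(4,5)`, masked (PHI) at the leaf) gives
`1 − |bias(B,r,λ)| ≥ (1 − 3^{−|S|} − Ψ(B))/32³` uniformly in `r, λ`; so `|bias| > 1 − c` forces `S(B) = ∅` or
`Ψ(B) > 1/3` (`abs_bias_le_of_good`).  The first set has `(19/27)^{2q}·3^{2q²}` elements (`sum_surv_empty`), the second
at most `3·Σ_B Ψ(B) ≤ 3(2/3)^{q−6}(97/81)^{2q}·3^{2q²}` (Markov, `sum_Psi_le`), and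
`(19/27)^{2q} + 3(2/3)^{q−6}(97/81)^{2q} ≤ (2251/64)(18818/19683)^q ≤ 2^{−q/10⁵}` for `q ≥ 100` (`numeric_tail`;
`(2/3)(97/81)² = 18818/19683`, `2^{−c} ≥ 1 − c·log 2`).  No Chernoff bound is needed: the generating function
`E(5/3)^{|S|} = (97/81)^{2q}` absorbs the fluctuation of the number of surviving rows.

WHAT THIS IS NOT: nothing about DENSE or structured systems ((P2♭′), (P2-complete)) or the crux; `c = 10⁻⁵` is not optimised
(the planner's heuristic exponent is `0.15q`).
-/

namespace Summit.QuantumAdvantage.AdviceFreeQNC0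

open Finset
open Literature.Computability.MetaComplexity

namespace AffBells21

/-! ## §2f statement (planner qa-qnc0-p1 g21, Sketch21.lean §2f — VERBATIM) -/

/-- **(P2-generic) `ParityMod3GenericBound`** (rung; provable from `DescentLemma` + `PhiBound` by the sketch above): there are `c > 0`, `q₀`
such that for `q ≥ q₀` the matrices `B : Fin (2q) → Fin q → ZMod 3` admitting SOME residues/linear term with `|bias| > 1 − c` number at most
`2^{−cq} · 3^{2q·q}`. -/
def ParityMod3GenericBound : Prop :=
  ∃ c : ℝ, 0 < c ∧ ∃ q₀ : ℕ, ∀ q ≥ q₀,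
    (((univ : Finset (Fin (2 * q) → Fin q → ZMod 3)).filter fun B =>
        ∃ (r : Fin (2 * q) → ZMod 3) (lam : Fin q → Bool), 1 - c < |bias q (2 * q) B r lam|).card : ℝ)
      ≤ (2 : ℝ) ^ (-(c * q)) * (3 : ℝ) ^ (2 * q * q)

/-! ## Proof of the rung -/

/-- `Ψ ≥ 0`. -/
theorem Psi_nonneg {q s : ℕ} (hq : 6 ≤ q) (B : Fin s → Fin q → ZMod 3) : 0 ≤ Psi hq B := by
  unfold Psi
  exact sum_nonneg fun ξ _ => by positivity

/-- **Good matrices have no near-constant parity**: if the path has a survivor and `Ψ(B) ≤ 1/3`, then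
`|bias(B, r, λ)| ≤ 1 − 1/98304` for ALL residues `r` and linear terms `λ`. -/
theorem abs_bias_le_of_good {q s : ℕ} (hq : 6 ≤ q) (B : Fin s → Fin q → ZMod 3) (hS : survS hq B ≠ ∅)
    (hΨ : Psi hq B ≤ 1 / 3) (r : Fin s → ZMod 3) (lam : Fin q → Bool) :
    |bias q s B r lam| ≤ 1 - 1 / 98304 := by
  have h := one_sub_abs_bias_ge hq B r lam
  have hcard : 1 ≤ (survS hq B).card := by
    rw [Nat.one_le_iff_ne_zero]
    exact fun h0 => hS (Finset.card_eq_zero.mp h0)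
  have h3 : (3 : ℝ)⁻¹ ^ (survS hq B).card ≤ (3 : ℝ)⁻¹ := by
    calc (3 : ℝ)⁻¹ ^ (survS hq B).card ≤ (3 : ℝ)⁻¹ ^ 1 :=
          pow_le_pow_of_le_one (by norm_num) (by norm_num) hcard
      _ = (3 : ℝ)⁻¹ := pow_one _
  nlinarith [h, h3, hΨ]

/-- The numerical tail: `(19/27)^{2q} + 3·(2/3)^{q−6}·(97/81)^{2q} ≤ 2^{−q/100000}` for `q ≥ 100`. -/
theorem numeric_tail (q : ℕ) (hq : 100 ≤ q) :
    (19 / 27 : ℝ) ^ (2 * q) + 3 * ((2 / 3 : ℝ) ^ (q - 6) * (97 / 81 : ℝ) ^ (2 * q))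
      ≤ (2 : ℝ) ^ (-((1 / 100000 : ℝ) * q)) := by
  set c : ℝ := 1 / 100000 with hc
  set ρ : ℝ := 18818 / 19683 with hρ
  -- rewrite the left-hand side as `(361/729)^q + (2187/64)·ρ^q`
  have h23 : (2 / 3 : ℝ) ^ (q - 6) = (3 / 2 : ℝ) ^ 6 * (2 / 3 : ℝ) ^ q := by
    have h : (2 / 3 : ℝ) ^ q = (2 / 3 : ℝ) ^ 6 * (2 / 3 : ℝ) ^ (q - 6) := by
      rw [← pow_add]; congr 1; omega
    rw [h, ← mul_assoc, ← mul_pow]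
    norm_num
  have hL : (19 / 27 : ℝ) ^ (2 * q) + 3 * ((2 / 3 : ℝ) ^ (q - 6) * (97 / 81 : ℝ) ^ (2 * q))
      = (361 / 729 : ℝ) ^ q + 2187 / 64 * ρ ^ q := by
    rw [h23, pow_mul, pow_mul, hρ]
    have e1 : ((19 / 27 : ℝ) ^ 2) = 361 / 729 := by norm_num
    have e2 : (2 / 3 : ℝ) ^ q * ((97 / 81 : ℝ) ^ 2) ^ q = (18818 / 19683 : ℝ) ^ q := by
      rw [← mul_pow]; norm_num
    rw [e1, mul_assoc ((3 / 2 : ℝ) ^ 6), e2]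
    norm_num
    ring
  rw [hL]
  -- `(361/729)^q ≤ ρ^q`
  have hρ0 : (0 : ℝ) ≤ ρ := by rw [hρ]; norm_num
  have h1 : (361 / 729 : ℝ) ^ q ≤ ρ ^ q :=
    pow_le_pow_left₀ (by norm_num) (by rw [hρ]; norm_num) q
  -- `ρ ≤ (24/25)(1 - c)`
  have h2 : ρ ^ q ≤ (24 / 25 : ℝ) ^ q * (1 - c) ^ q := by
    rw [← mul_pow]
    exact pow_le_pow_left₀ hρ0 (by rw [hρ, hc]; norm_num) q
  -- `(2251/64)(24/25)^q ≤ 1`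
  have h3 : (2251 / 64 : ℝ) * (24 / 25 : ℝ) ^ q ≤ 1 := by
    have h100 : (24 / 25 : ℝ) ^ q ≤ (24 / 25 : ℝ) ^ 100 := pow_le_pow_of_le_one (by norm_num) (by norm_num) hq
    have hnum : (2251 / 64 : ℝ) * (24 / 25 : ℝ) ^ 100 ≤ 1 := by norm_num
    nlinarith [h100]
  -- `(1 - c)^q ≤ 2^{-cq}`
  have h4 : (1 - c) ^ q ≤ (2 : ℝ) ^ (-(c * q)) := by
    have hle : 1 - c ≤ (2 : ℝ) ^ (-c) := by
      rw [Real.rpow_def_of_pos (by norm_num : (0 : ℝ) < 2)]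
      have hlog : Real.log 2 ≤ 1 := by
        have := Real.log_le_sub_one_of_pos (by norm_num : (0 : ℝ) < 2)
        linarith
      have hlog0 : 0 ≤ Real.log 2 := Real.log_nonneg (by norm_num)
      have hexp := Real.add_one_le_exp (Real.log 2 * (-c))
      have hc0 : 0 ≤ c := by rw [hc]; norm_num
      nlinarith [hexp, hlog, hlog0, hc0]
    have hc1 : 0 ≤ 1 - c := by rw [hc]; norm_num
    calc (1 - c) ^ q ≤ ((2 : ℝ) ^ (-c)) ^ q := pow_le_pow_left₀ hc1 hle q
      _ = (2 : ℝ) ^ (-(c * q)) := by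
          rw [← Real.rpow_natCast, ← Real.rpow_mul (by norm_num : (0 : ℝ) ≤ 2)]
          congr 1
          ring
  have hcq : 0 ≤ (1 - c) ^ q := pow_nonneg (by rw [hc]; norm_num) q
  calc (361 / 729 : ℝ) ^ q + 2187 / 64 * ρ ^ q ≤ ρ ^ q + 2187 / 64 * ρ ^ q := by linarith
    _ = 2251 / 64 * ρ ^ q := by ring
    _ ≤ 2251 / 64 * ((24 / 25 : ℝ) ^ q * (1 - c) ^ q) := by gcongr
    _ = (2251 / 64 * (24 / 25 : ℝ) ^ q) * (1 - c) ^ q := by ring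
    _ ≤ 1 * (1 - c) ^ q := mul_le_mul_of_nonneg_right h3 hcq
    _ ≤ (2 : ℝ) ^ (-(c * q)) := by rw [one_mul]; exact h4

/-- **(P2-generic) PROVED**: `ParityMod3GenericBound` with `c = 10⁻⁵`, `q₀ = 100`.  For every `B` outside a set of
`≤ [(19/27)^{2q} + 3(2/3)^{q−6}(97/81)^{2q}]·3^{2q²}` matrices (no survivor of the three-pair path, or Markov for `Ψ`),
the one-path descent gives `|bias(B, r, λ)| ≤ 1 − 1/98304` for all `r, λ`. -/
theorem parityMod3GenericBound : ParityMod3GenericBound := by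
  refine ⟨1 / 100000, by norm_num, 100, fun q hq100 => ?_⟩
  have hq : 6 ≤ q := le_trans (by norm_num) hq100
  set c : ℝ := 1 / 100000 with hc
  -- the bad set is contained in {no survivor} ∪ {Ψ > 1/3}
  have hsub : ((univ : Finset (Fin (2 * q) → Fin q → ZMod 3)).filter fun B =>
        ∃ (r : Fin (2 * q) → ZMod 3) (lam : Fin q → Bool), 1 - c < |bias q (2 * q) B r lam|)
      ⊆ ((univ : Finset (Fin (2 * q) → Fin q → ZMod 3)).filter fun B => survS hq B = ∅)
        ∪ ((univ : Finset (Fin (2 * q) → Fin q → ZMod 3)).filter fun B => 1 / 3 < Psi hq B) := by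
    intro B hB
    rw [mem_filter] at hB
    obtain ⟨r, lam, hlt⟩ := hB.2
    rw [mem_union, mem_filter, mem_filter]
    by_contra hnot
    have hS : survS hq B ≠ ∅ := fun h => hnot (Or.inl ⟨mem_univ _, h⟩)
    have hΨ : Psi hq B ≤ 1 / 3 := le_of_not_gt fun h => hnot (Or.inr ⟨mem_univ _, h⟩)
    have hgood := abs_bias_le_of_good hq B hS hΨ r lam
    rw [hc] at hlt
    linarith
  -- count of {no survivor}
  have hA : (((univ : Finset (Fin (2 * q) → Fin q → ZMod 3)).filter fun B => survS hq B = ∅).card : ℝ)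
      = (19 / 27 : ℝ) ^ (2 * q) * ((3 : ℝ) ^ (2 * q)) ^ q := by
    rw [Finset.natCast_card_filter]
    exact sum_surv_empty hq
  -- Markov for Ψ
  have hC : (((univ : Finset (Fin (2 * q) → Fin q → ZMod 3)).filter fun B => 1 / 3 < Psi hq B).card : ℝ)
      ≤ 3 * ((2 / 3 : ℝ) ^ (q - 6) * (97 / 81 : ℝ) ^ (2 * q) * ((3 : ℝ) ^ (2 * q)) ^ q) := by
    rw [Finset.natCast_card_filter]
    calc ∑ B : Fin (2 * q) → Fin q → ZMod 3, (if 1 / 3 < Psi hq B then (1 : ℝ) else 0)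
        ≤ ∑ B : Fin (2 * q) → Fin q → ZMod 3, 3 * Psi hq B := by
          refine sum_le_sum fun B _ => ?_
          have h0 := Psi_nonneg hq B
          split_ifs with h <;> linarith
      _ = 3 * ∑ B : Fin (2 * q) → Fin q → ZMod 3, Psi hq B := by rw [mul_sum]
      _ ≤ 3 * ((2 / 3 : ℝ) ^ (q - 6) * (97 / 81 : ℝ) ^ (2 * q) * ((3 : ℝ) ^ (2 * q)) ^ q) :=
          mul_le_mul_of_nonneg_left (sum_Psi_le hq) (by norm_num)
  -- assemble
  have hcard := card_le_card hsub
  have hunion := card_union_le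
    ((univ : Finset (Fin (2 * q) → Fin q → ZMod 3)).filter fun B => survS hq B = ∅)
    ((univ : Finset (Fin (2 * q) → Fin q → ZMod 3)).filter fun B => 1 / 3 < Psi hq B)
  have hpow : ((3 : ℝ) ^ (2 * q)) ^ q = (3 : ℝ) ^ (2 * q * q) := by rw [← pow_mul]
  have htail := numeric_tail q hq100
  have h3pos : (0 : ℝ) ≤ (3 : ℝ) ^ (2 * q * q) := by positivity
  calc (((univ : Finset (Fin (2 * q) → Fin q → ZMod 3)).filter fun B =>
          ∃ (r : Fin (2 * q) → ZMod 3) (lam : Fin q → Bool), 1 - c < |bias q (2 * q) B r lam|).card : ℝ)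
      ≤ ((((univ : Finset (Fin (2 * q) → Fin q → ZMod 3)).filter fun B => survS hq B = ∅).card : ℕ) : ℝ)
        + ((((univ : Finset (Fin (2 * q) → Fin q → ZMod 3)).filter fun B => 1 / 3 < Psi hq B).card : ℕ) : ℝ) := by
        exact_mod_cast hcard.trans hunion
    _ ≤ (19 / 27 : ℝ) ^ (2 * q) * ((3 : ℝ) ^ (2 * q)) ^ q
        + 3 * ((2 / 3 : ℝ) ^ (q - 6) * (97 / 81 : ℝ) ^ (2 * q) * ((3 : ℝ) ^ (2 * q)) ^ q) := by
        rw [hA]; linarith [hC]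
    _ = ((19 / 27 : ℝ) ^ (2 * q) + 3 * ((2 / 3 : ℝ) ^ (q - 6) * (97 / 81 : ℝ) ^ (2 * q)))
        * (3 : ℝ) ^ (2 * q * q) := by rw [hpow]; ring
    _ ≤ (2 : ℝ) ^ (-(c * q)) * (3 : ℝ) ^ (2 * q * q) := by
        rw [hc]
        exact mul_le_mul_of_nonneg_right htail h3pos

end AffBells21

end Summit.QuantumAdvantage.AdviceFreeQNC0
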